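import Literature.NumberTheory.GaloisRepresentations.WeilGroupProofs
import Mathlib.Topology.Algebra.OpenSubgroup
import Mathlib.GroupTheory.OrderOfElement
import HarnessLib

/-!
# Powers in the Weil group: open subgroups of inertia, `deg` of powers, a central Frobenius power

Topic `NumberTheory/GaloisRepresentations`; namespace
`Literature.NumberTheory.GaloisRepresentations.WeilGroup` (dot-notation lemmas on the accepted
`WeilGroup F` of a non-archimedean local field `F`). Consequences of the discharged facts
`WeilGroup.isCompact_inertia_holds`, `WeilGroup.isTopologicalGroup_holds` (`WeilGroupProofs`),
`IsFrobPow.mul_holds`, `IsFrobPow.unique_holds`, `absInertia_normal_holds`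
(`LocalGaloisGroupProofs`) used by the Weil–Deligne dictionary
(`WeilDeligneOfGaloisProofs.lean`; Deligne, Antwerp II (1973), §8.4.2):

* `exists_pow_mem_of_isOpen` — an open subgroup `V` of `W_F` meets the compact `I_F` with finite
  index, so every `u ∈ I_F` has a power `u ^ k ∈ V`, `k ≥ 1`;
* `deg_zpow`, `deg_pow`, `zpow_deg_mul_mem_inertia`, `subgroup_eq_top_of_inertia_le` — `W_F` is
  generated by `I_F` and any geometric Frobenius `Φ` (`deg Φ = -1`): `w = Φ^{-deg w} (Φ^{deg w} w)`;
* `intertwines_of_inertia_of_frob` — for homomorphisms `R, R' : W_F →* M` into a monoid, the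
  relation `A · R(w) = R'(w) · A` holds for all `w` as soon as it holds on `I_F` and at `Φ`
  (the set of such `w` is a subgroup);
* `exists_pow_commute_of_isOpen_ker` — if `ρ : W_F →* M` kills an open subgroup, then for every
  `Φ` some `ρ(Φ ^ k)`, `k ≥ 1`, commutes with `ρ(I_F)`: the image `ρ(I_F)` is finite and
  conjugation by `ρ(Φ)` permutes it, hence has finite order on it. For a Weil–Deligne or `ℓ`-adic
  representation this is the standard "`ρ(Φ)^k` is central in the image" step
  (Deligne 1973, §8.4.2; Tate, Corvallis 1979, (4.1.3)).

## Mathlib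

`Subgroup.quotient_finite_of_isOpen` (open subgroups of compact groups have finite index),
`Subgroup.exists_pow_mem_of_index_ne_zero`, `isOfFinOrder_of_finite`,
`Finite.injective_iff_bijective`. No Weil groups in Mathlib.

## References

* P. Deligne, *Les constantes des équations fonctionnelles des fonctions `L`*, Antwerp II,
  LNM 349 (1973), §2.2, §8.4.2. [DeligneAntwerpII1973]
* J. Tate, *Number theoretic background*, Corvallis 1979, (1.4.1), (4.1.3). [TateCorvallis1979]
-/

noncomputable section

namespace Literature.NumberTheory.GaloisRepresentations

namespace WeilGroup

variable {F : Type*} [Field F] [ValuativeRel F] [TopologicalSpace F] [IsNonarchimedeanLocalField F]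

/-- Every element of the inertia group has a positive power in any given open subgroup of `W_F`:
`I_F` is compact (`isCompact_inertia_holds`) and `W_F` a topological group
(`isTopologicalGroup_holds`), so an open subgroup meets `I_F` with finite index.
[cite: TateCorvallis1979, (1.4.1)] -/
theorem exists_pow_mem_of_isOpen (V : Subgroup (WeilGroup F))
    (hV : IsOpen (V : Set (WeilGroup F))) {u : WeilGroup F} (hu : u ∈ inertia F) :
    ∃ k : ℕ, 0 < k ∧ u ^ k ∈ V := by
  haveI : IsTopologicalGroup (WeilGroup F) := isTopologicalGroup_holds F
  haveI : CompactSpace (inertia F) := isCompact_iff_compactSpace.mp (isCompact_inertia_holds F)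
  have hfin : Finite ((inertia F) ⧸ V.subgroupOf (inertia F)) :=
    Subgroup.quotient_finite_of_isOpen _ (Subgroup.subgroupOf_isOpen (inertia F) V hV)
  have hidx : (V.subgroupOf (inertia F)).index ≠ 0 :=
    Subgroup.index_ne_zero_iff_finite.mpr hfin
  obtain ⟨k, hk, -, hmem⟩ := Subgroup.exists_pow_mem_of_index_ne_zero hidx ⟨u, hu⟩
  exact ⟨k, hk, by simpa [Subgroup.mem_subgroupOf] using hmem⟩

/-- `deg (Φ ^ m) = m * deg Φ` for `m : ℤ` (`deg` is a homomorphism, `degHom`).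
[cite: TateCorvallis1979, (1.4.1)] -/
theorem deg_zpow (Φ : WeilGroup F) (m : ℤ) : deg (Φ ^ m) = m * deg Φ := by
  have h := map_zpow (degHom F IsFrobPow.mul_holds IsFrobPow.unique_holds) Φ m
  simp only [degHom_apply] at h
  apply Multiplicative.ofAdd.injective
  rw [h, ← ofAdd_zsmul, smul_eq_mul]

/-- `deg (Φ ^ k) = k * deg Φ` for `k : ℕ`. [cite: TateCorvallis1979, (1.4.1)] -/
theorem deg_pow (Φ : WeilGroup F) (k : ℕ) : deg (Φ ^ k) = k * deg Φ := by
  rw [← zpow_natCast, deg_zpow]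

/-- For a geometric Frobenius `Φ` (`deg Φ = -1`), `Φ ^ (deg w) * w` lies in the inertia group.
[cite: TateCorvallis1979, (1.4.1)] -/
theorem zpow_deg_mul_mem_inertia {Φ : WeilGroup F} (hΦ : deg Φ = -1) (w : WeilGroup F) :
    Φ ^ (deg w) * w ∈ inertia F := by
  rw [← deg_eq_zero_iff_mem_inertia IsFrobPow.mul_holds IsFrobPow.unique_holds,
    deg_mul IsFrobPow.mul_holds IsFrobPow.unique_holds, deg_zpow, hΦ]
  ring

/-- `W_F` is generated by `I_F` and a geometric Frobenius: a subgroup of `W_F` containing the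
inertia group and some `Φ` with `deg Φ = -1` is everything. [cite: TateCorvallis1979, (1.4.1)] -/
theorem subgroup_eq_top_of_inertia_le {S : Subgroup (WeilGroup F)} {Φ : WeilGroup F}
    (hΦ : deg Φ = -1) (hΦS : Φ ∈ S) (hI : inertia F ≤ S) : S = ⊤ := by
  rw [eq_top_iff]
  intro w _
  have h1 : Φ ^ (deg w) * w ∈ S := hI (zpow_deg_mul_mem_inertia hΦ w)
  have h2 : (Φ ^ (deg w))⁻¹ * (Φ ^ (deg w) * w) ∈ S :=
    S.mul_mem (S.inv_mem (S.zpow_mem hΦS _)) h1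
  simpa using h2

/-- `I_F` is normal in `W_F` (`absInertia_normal_holds`): conjugates of inertia elements are in
inertia. [cite: TateCorvallis1979, (1.4.1)] -/
theorem conj_mem_inertia {u : WeilGroup F} (hu : u ∈ inertia F) (w : WeilGroup F) :
    w * u * w⁻¹ ∈ inertia F :=
  (inertia_normal (absInertia_normal_holds F)).conj_mem u hu w

section Central

variable {M : Type*} [Monoid M]

/-- For homomorphisms `R, R' : W_F →* M` into a monoid and `A ∈ M`, the intertwining relation
`A · R(w) = R'(w) · A` holds for every `w ∈ W_F` as soon as it holds for `w ∈ I_F` and for one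
geometric Frobenius `Φ` (the set of such `w` is a subgroup, and `W_F = ⟨Φ, I_F⟩`). [folklore] -/
theorem intertwines_of_inertia_of_frob (R R' : WeilGroup F →* M) (A : M) {Φ : WeilGroup F}
    (hΦ : deg Φ = -1) (hAΦ : A * R Φ = R' Φ * A) (hAI : ∀ u ∈ inertia F, A * R u = R' u * A)
    (w : WeilGroup F) : A * R w = R' w * A := by
  let S : Subgroup (WeilGroup F) :=
    { carrier := {w | A * R w = R' w * A}
      mul_mem' := fun {a b} ha hb => by
        simp only [Set.mem_setOf_eq, map_mul] at ha hb ⊢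
        rw [← mul_assoc, ha, mul_assoc, hb, mul_assoc]
      one_mem' := by simp
      inv_mem' := fun {a} ha => by
        simp only [Set.mem_setOf_eq] at ha ⊢
        have h1 : R a * R a⁻¹ = 1 := by rw [← map_mul, mul_inv_cancel, map_one]
        have h2 : R' a⁻¹ * R' a = 1 := by rw [← map_mul, inv_mul_cancel, map_one]
        calc A * R a⁻¹ = R' a⁻¹ * R' a * A * R a⁻¹ := by rw [h2, one_mul]
          _ = R' a⁻¹ * (A * R a) * R a⁻¹ := by rw [mul_assoc (R' a⁻¹) (R' a) A, ← ha]
          _ = R' a⁻¹ * A * (R a * R a⁻¹) := by simp only [mul_assoc]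
          _ = R' a⁻¹ * A := by rw [h1, mul_one] }
  have hS : S = ⊤ := subgroup_eq_top_of_inertia_le hΦ hAΦ fun u hu => hAI u hu
  have hw : w ∈ S := hS ▸ Subgroup.mem_top w
  exact hw

/-- **A central Frobenius power.** If `ρ : W_F →* M` is trivial on an open subgroup of `W_F`
(e.g. a Weil–Deligne representation, `WeilGroup.IsContinuousRep`), then for every `Φ ∈ W_F` some
positive power `ρ (Φ ^ k)` commutes with `ρ (I_F)`: the image of the compact `I_F` is finite
(`exists_pow_mem_of_isOpen`-type finiteness, `Subgroup.quotient_finite_of_isOpen`), conjugation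
by `ρ Φ` is an injective self-map of it (`I_F` is normal), hence a permutation of finite order.
[cite: DeligneAntwerpII1973, §8.4.2] -/
theorem exists_pow_commute_of_isOpen_ker (ρ : WeilGroup F →* M) (U : Subgroup (WeilGroup F))
    (hUo : IsOpen (U : Set (WeilGroup F))) (hU : ∀ u ∈ U, ρ u = 1) (Φ : WeilGroup F) :
    ∃ k : ℕ, 0 < k ∧ ∀ u ∈ inertia F, Commute (ρ (Φ ^ k)) (ρ u) := by
  classical
  haveI : IsTopologicalGroup (WeilGroup F) := isTopologicalGroup_holds F
  haveI : CompactSpace (inertia F) := isCompact_iff_compactSpace.mp (isCompact_inertia_holds F)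
  -- the image of inertia is finite
  set U' : Subgroup (inertia F) := U.subgroupOf (inertia F) with hU'
  haveI hfin : Finite ((inertia F) ⧸ U') :=
    Subgroup.quotient_finite_of_isOpen _ (Subgroup.subgroupOf_isOpen (inertia F) U hUo)
  let f : inertia F → M := fun u => ρ u
  have hf : ∀ a b : inertia F, QuotientGroup.leftRel U' a b → f a = f b := by
    intro a b hab
    rw [QuotientGroup.leftRel_apply] at hab
    have h1 : ρ ((a : WeilGroup F)⁻¹ * b) = 1 :=
      hU _ (by simpa [hU', Subgroup.mem_subgroupOf] using hab)
    have h2 : (b : WeilGroup F) = a * ((a : WeilGroup F)⁻¹ * b) := by group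
    change ρ a = ρ b
    rw [h2, map_mul, h1, mul_one]
  let g : (inertia F) ⧸ U' → M := Quotient.lift f hf
  set T : Set M := ρ '' (inertia F : Set (WeilGroup F)) with hT
  have hTfin : T.Finite := by
    refine (Set.finite_range g).subset ?_
    rintro _ ⟨u, hu, rfl⟩
    exact ⟨(QuotientGroup.mk ⟨u, hu⟩ : (inertia F) ⧸ U'), rfl⟩
  haveI : Finite T := hTfin.to_subtype
  -- conjugation by `ρ Φ` as a permutation of `T`
  have hinv1 : ρ Φ⁻¹ * ρ Φ = 1 := by rw [← map_mul, inv_mul_cancel, map_one]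
  let c : M → M := fun x => ρ Φ * x * ρ Φ⁻¹
  have key : ∀ z, ρ Φ⁻¹ * (ρ Φ * z * ρ Φ⁻¹) * ρ Φ = z := by
    intro z
    simp only [← mul_assoc]
    rw [hinv1, one_mul, mul_assoc, hinv1, mul_one]
  have hc_inj : Function.Injective c := by
    intro x y hxy
    have := congrArg (fun z => ρ Φ⁻¹ * z * ρ Φ) hxy
    simpa only [c, key] using this
  have hcT : ∀ x ∈ T, c x ∈ T := by
    rintro _ ⟨u, hu, rfl⟩
    refine ⟨Φ * u * Φ⁻¹, conj_mem_inertia hu Φ, ?_⟩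
    simp only [c, map_mul]
  let cT : T → T := fun x => ⟨c x, hcT x x.2⟩
  have hcT_inj : Function.Injective cT := fun x y hxy =>
    Subtype.ext (hc_inj (congrArg Subtype.val hxy))
  have hcT_bij : Function.Bijective cT := Finite.injective_iff_bijective.mp hcT_inj
  let σ : Equiv.Perm T := Equiv.ofBijective cT hcT_bij
  obtain ⟨k, hk, hσk⟩ := (isOfFinOrder_of_finite σ).exists_pow_eq_one
  -- iterating the conjugation
  have hiter : ∀ (j : ℕ) (x : M), c^[j] x = ρ Φ ^ j * x * ρ Φ⁻¹ ^ j := by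
    intro j
    induction j with
    | zero => intro x; simp
    | succ j ih =>
      intro x
      rw [Function.iterate_succ_apply', ih]
      simp only [c]
      rw [pow_succ' (ρ Φ), pow_succ (ρ Φ⁻¹)]
      simp only [mul_assoc]
  have hσiter : ∀ (j : ℕ) (x : T), ((σ ^ j) x : M) = c^[j] x := by
    intro j
    induction j with
    | zero => intro x; simp
    | succ j ih =>
      intro x
      rw [pow_succ', Equiv.Perm.mul_apply, Function.iterate_succ_apply']
      change c ((σ ^ j) x) = _
      rw [ih]
  refine ⟨k, hk, fun u hu => ?_⟩
  have hx : (⟨ρ u, ⟨u, hu, rfl⟩⟩ : T) = (σ ^ k) ⟨ρ u, ⟨u, hu, rfl⟩⟩ := by rw [hσk]; rfl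
  have hx' := congrArg Subtype.val hx
  rw [hσiter] at hx'
  change ρ u = c^[k] (ρ u) at hx'
  rw [hiter] at hx'
  -- `ρ u = ρΦ^k ρu ρΦ⁻¹^k`; multiply by `ρΦ^k` on the right
  have hpow : ρ Φ⁻¹ ^ k * ρ Φ ^ k = 1 := by
    rw [← map_pow, ← map_pow, ← map_mul, inv_pow, inv_mul_cancel, map_one]
  have := congrArg (fun z => z * ρ Φ ^ k) hx'
  simp only [mul_assoc, hpow, mul_one] at this
  rw [map_pow]
  exact this.symm

end Central

end WeilGroup

end Literature.NumberTheory.GaloisRepresentations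

end
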